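import Mathlib
import HarnessLib
import Summits.CriticalPhenomena.CardyFormulaZ2.Theses.CardySelfRefinement
import Literature.Probability.RandomPlanarGeometry.ChordalReversibility
import Literature.Probability.RandomPlanarGeometry.ConformalRectangle
import Literature.Probability.RandomPlanarGeometry.IsometryCovariance
import Literature.Probability.Percolation.IkhlefPonsaingFirstPassage
import Literature.Probability.Percolation.LatticeSymmetry
import Summits.CriticalPhenomena.CardyFormulaZ2.Theorems.CardySelfRefinementSymmetryUpgradeRTouchWiredArmGlue
import Summits.CriticalPhenomena.CardyFormulaZ2.Theorems.CardySelfRefinementSymmetryUpgradeRTouchWiredArmRegion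

/-!
# Lower lattice bound, WIRED ARM: `P_{1/2}[wired arc ↔ B(z, ε/4) in bcBondConfig ω] ≥ c ε^{1/3}`
# at the diagonal free arc of the triangle domain (conditional on Ikhlef–Ponsaing, Prop. 4.7)

Helper file for stub `stub_touchExponent` (S3) of line `SketchIdeatorTwo` of crux `SymmetryUpgradeR`
(stmt-CriticalPhenomena-17239, route CardySelfRefinement): the registered helper L2
`touchExponent_wiredArmLower`, the hypothesis `hL2` of the lead's `touchExponent_plan`.

For the triangle Dobrushin domain `(Δ; -1, -i)` (`Δ = {re < 0, im < 0, re + im > -1}`, wired arc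
the axis-parallel legs, free arc the hypotenuse) and every `ℤ²`-discretisation family `E` of it:
`∃ c ε₀ > 0, ∀ ε ∈ (0, ε₀), ∀ᶠ δ, c ε^{1/3} ≤ P_{1/2}[some site of the discrete wired arc is
joined, in the completed configuration bcBondConfig ω, to a site within ε/4 of z, and some site
of the discrete free arc lies within ε/4 of z]`, `z = -(1+i)/2`, CONDITIONAL on
`Literature.Probability.Percolation.IkhlefPonsaingFirstPassage`.

Proof. Scales (`touchExponent_wired_scales`): `a = ⌊1/(64δ)⌋` (gluing scale), `r = ⌊ε/(16δ)⌋`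
(inner scale), `p = ⌊-1/δ⌋`, `q = ⌊-1/(2δ)⌋`; level-`0` base point `b₀ = (q - p - 1, p + 1 - q)`
(`hgtOf b₀ = 0`, `col b₀ = 2q - 2p - 2 ≍ 1/δ`), shift `t = (p + 5, 0)` to the level `L = p + 5`
(four rows above the lowest row of the triangle), `b₀ + t` within `7δ` of `z`. At level `0` the
glued event of part 1 (`touchExponent_wiredArmLower_glue`: probability `≥ c (r/2a)^{1/3} ≥ c ε^{1/3}`)
gives an open path from a site `x` with `ν_{b₀}(x) = r` to a site of the row `v₁ = -1` inside
`{a ≤ col ≤ col b₀ + 2a, 0 ≤ hgtOf ≤ 2a, v₁ ≤ -1}` (`touchExponent_glue0`). Translating by `t`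
(`relabel_mem_openConnIn`; `P_{1/2}` is translation invariant,
`bondPercolation_real_preimage_relabel_iso`), the region lands in the discrete triangle, four rows
above the hypotenuse and away from the acute corners (`touchExponent_wired_region`), hence off the
discrete free arc (part 2, `touchExponent_notMem_zdArcB`); so the translated path is open in
`bcBondConfig` (`touchExponent_bc_openConnIn`), ends on the discrete wired arc
(`touchExponent_mem_zdArcA_of_row`) and starts within `2δr + 7δ ≤ ε/4` of `z`
(`touchExponent_dist_le_norm`); the free-arc site is `touchExponent_wiredArmLower_freeSite`.
-/

noncomputable section

namespace Summit.CriticalPhenomena.CardyFormulaZ2.Theorems.SymmetryUpgradeR.SwallowingSkeleton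

open MeasureTheory Filter Set Metric
open Literature.Probability.RandomPlanarGeometry Literature.Probability.LatticeModels
  Literature.Probability.Percolation
open UpperHalfPlane (upperHalfPlaneSet)
open Literature.Probability.Percolation.TrackExchange
open scoped Topology

local notation3 "Δ" => {w : ℂ | w.re < 0 ∧ w.im < 0 ∧ -1 < w.re + w.im}
local notation3 "ν[" b ", " v "]" => max |col v - col b| (hgtOf v - hgtOf b)
local notation3 "box[" A₁ ", " A₂ ", " B₁ ", " B₂ "]" =>
  {v : Site 2 | A₁ ≤ col v ∧ col v ≤ A₂ ∧ B₁ ≤ hgtOf v ∧ hgtOf v ≤ B₂}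
local notation3 "μ" => bondPercolation (zdGraph 2) half

/-! ### Numerology of the scales -/

/-- **The scales.** With `a = ⌊1/(64δ)⌋` (the gluing scale, `≍ 1/δ`), `r = ⌊ε/(16δ)⌋` (the inner
scale, `≍ ε/δ`), `p = ⌊-1/δ⌋`, `q = ⌊-1/(2δ)⌋` (so that the level-`0` base point has
`col = 2q - 2p - 2 ≍ 1/δ`): all the integer and real inequalities consumed by the gluing, the
region bookkeeping and the final comparison, for `0 < ε < 1/8` and
`0 < δ ≤ ε / (64 (m₀ + 1)) ⊓ 1/4096`. -/
theorem touchExponent_wired_scales {ε δ : ℝ} {m₀ a r : ℕ} {p q : ℤ} (hε0 : 0 < ε) (hε1 : ε < 1 / 8)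
    (hδ : 0 < δ) (hδε : δ ≤ ε / (64 * ((m₀ : ℝ) + 1))) (hδ1 : δ ≤ 1 / 4096)
    (ha : a = ⌊1 / (64 * δ)⌋₊) (hr : r = ⌊ε / (16 * δ)⌋₊) (hp : p = ⌊-1 / δ⌋)
    (hq : q = ⌊-1 / (2 * δ)⌋) :
    m₀ ≤ r ∧ m₀ ≤ a ∧ r ≤ a ∧ 1 ≤ a ∧ 3 * (a : ℤ) ≤ 2 * q - 2 * p - 2 ∧
      2 * (r : ℤ) + 2 ≤ 2 * q - 2 * p - 2 ∧ 0 ≤ 2 * q - 2 * p - 2 + a ∧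
      2 * q - 2 * p - 2 + a ≤ 67 * (a : ℤ) ∧ 4 * (a : ℤ) + 2 * q + 8 ≤ -6 ∧
      -1 + 1 / 128 + 2 * δ ≤ δ * ((a : ℝ) + 2 * p + 10) / 2 ∧ -1 < δ * ((p : ℝ) + 5) ∧
      2 * δ * r + 7 * δ ≤ ε / 4 ∧ 3 * δ ≤ ε / 4 ∧ ε ≤ (r : ℝ) / (2 * a) ∧ (0 : ℝ) < a := by
  -- `δ`-scaled floor facts
  have ha1 : (a : ℝ) * (64 * δ) ≤ 1 := by
    rw [← le_div_iff₀ (by positivity), ha]; exact Nat.floor_le (by positivity)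
  have ha2 : 1 < ((a : ℝ) + 1) * (64 * δ) := by
    rw [← div_lt_iff₀ (by positivity), ha]; exact Nat.lt_floor_add_one _
  have hr1 : (r : ℝ) * (16 * δ) ≤ ε := by
    rw [← le_div_iff₀ (by positivity), hr]; exact Nat.floor_le (by positivity)
  have hr2 : ε < ((r : ℝ) + 1) * (16 * δ) := by
    rw [← div_lt_iff₀ (by positivity), hr]; exact Nat.lt_floor_add_one _
  have hp1 : (p : ℝ) * δ ≤ -1 := by
    rw [← le_div_iff₀ hδ, hp]; exact Int.floor_le _
  have hp2 : -1 < ((p : ℝ) + 1) * δ := by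
    rw [← div_lt_iff₀ hδ, hp]; exact Int.lt_floor_add_one _
  have hq1 : (q : ℝ) * (2 * δ) ≤ -1 := by
    rw [← le_div_iff₀ (by positivity), hq]; exact Int.floor_le _
  have hq2 : -1 < ((q : ℝ) + 1) * (2 * δ) := by
    rw [← div_lt_iff₀ (by positivity), hq]; exact Int.lt_floor_add_one _
  have hδε' : δ * (64 * ((m₀ : ℝ) + 1)) ≤ ε := by rwa [le_div_iff₀ (by positivity)] at hδε
  have hm₀ : (0 : ℝ) ≤ m₀ := Nat.cast_nonneg _
  have hδε1 : 64 * δ ≤ ε := by nlinarith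
  have h16 : (0 : ℝ) < 16 * δ := by positivity
  have h64 : (0 : ℝ) < 64 * δ := by positivity
  -- the conclusions, one by one
  have c1 : m₀ ≤ r := by
    have k : (4 * ((m₀ : ℝ) + 1)) * (16 * δ) < ((r : ℝ) + 1) * (16 * δ) := by linarith
    have k' := lt_of_mul_lt_mul_right k h16.le
    have : (m₀ : ℝ) < r + 1 := by linarith
    exact Nat.lt_succ_iff.1 (by exact_mod_cast this)
  have c2 : m₀ ≤ a := by
    have k : ((m₀ : ℝ) + 1) * (64 * δ) < ((a : ℝ) + 1) * (64 * δ) := by linarith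
    have k' := lt_of_mul_lt_mul_right k h64.le
    have : (m₀ : ℝ) < a + 1 := by linarith
    exact Nat.lt_succ_iff.1 (by exact_mod_cast this)
  have c3 : r ≤ a := by
    have k : (r : ℝ) * (64 * δ) < ((a : ℝ) + 1) * (64 * δ) := by linarith
    have k' := lt_of_mul_lt_mul_right k h64.le
    exact Nat.lt_succ_iff.1 (by exact_mod_cast k')
  have c4 : 1 ≤ a := by
    have k : (64 : ℝ) * (64 * δ) < ((a : ℝ) + 1) * (64 * δ) := by linarith
    have k' := lt_of_mul_lt_mul_right k h64.le
    have : (1 : ℝ) < a := by linarith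
    exact_mod_cast this.le
  have c5 : 3 * (a : ℤ) ≤ 2 * q - 2 * p - 2 := by
    have k : (3 * (a : ℝ)) * δ < (2 * (q : ℝ) - 2 * p - 1) * δ := by linarith
    have k' := lt_of_mul_lt_mul_right k hδ.le
    have : 3 * (a : ℤ) < 2 * q - 2 * p - 1 := by exact_mod_cast k'
    omega
  have c6 : 2 * (r : ℤ) + 2 ≤ 2 * q - 2 * p - 2 := by
    have k : (2 * (r : ℝ) + 2) * δ < (2 * (q : ℝ) - 2 * p - 1) * δ := by nlinarith
    have k' := lt_of_mul_lt_mul_right k hδ.le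
    have : 2 * (r : ℤ) + 2 < 2 * q - 2 * p - 1 := by exact_mod_cast k'
    omega
  have c7 : 0 ≤ 2 * q - 2 * p - 2 + a := by
    have k : (0 : ℝ) * δ < (2 * (q : ℝ) - 2 * p - 2 + a) * δ := by nlinarith
    have k' := lt_of_mul_lt_mul_right k hδ.le
    have : (0 : ℤ) < 2 * q - 2 * p - 2 + a := by exact_mod_cast k'
    omega
  have c8 : 2 * q - 2 * p - 2 + a ≤ 67 * (a : ℤ) := by
    have k : (2 * (q : ℝ) - 2 * p - 2) * δ < (66 * (a : ℝ) + 1) * δ := by nlinarith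
    have k' := lt_of_mul_lt_mul_right k hδ.le
    have : 2 * q - 2 * p - 2 < 66 * (a : ℤ) + 1 := by exact_mod_cast k'
    omega
  have c9 : 4 * (a : ℤ) + 2 * q + 8 ≤ -6 := by
    have k : (4 * (a : ℝ) + 2 * q + 8) * δ < (-5 : ℝ) * δ := by nlinarith
    have k' := lt_of_mul_lt_mul_right k hδ.le
    have : 4 * (a : ℤ) + 2 * q + 8 < -5 := by exact_mod_cast k'
    omega
  have c10 : -1 + 1 / 128 + 2 * δ ≤ δ * ((a : ℝ) + 2 * p + 10) / 2 := by nlinarith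
  have c11 : -1 < δ * ((p : ℝ) + 5) := by nlinarith
  have c12 : 2 * δ * r + 7 * δ ≤ ε / 4 := by nlinarith
  have c13 : 3 * δ ≤ ε / 4 := by linarith
  have c15 : (0 : ℝ) < a := by
    have : (1 : ℝ) ≤ a := by exact_mod_cast c4
    linarith
  have c14 : ε ≤ (r : ℝ) / (2 * a) := by
    rw [le_div_iff₀ (by positivity)]
    have k : (ε * (2 * a)) * (16 * δ) < (r : ℝ) * (16 * δ) := by
      nlinarith [mul_nonneg hε0.le (sub_nonneg.2 ha1)]
    exact (lt_of_mul_lt_mul_right k h16.le).le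
  exact ⟨c1, c2, c3, c4, c5, c6, c7, c8, c9, c10, c11, c12, c13, c14, c15⟩

/-- **The region at the level of the triangle.** A site `w` of the shifted box
`{a + L ≤ col ≤ 2q - 2p - 2 + 2a + L, L ≤ hgtOf ≤ 2a + L}` (`L = p + 5`) with `w₁ ≤ -1` satisfies
`w₀ ≤ -3`, `δ w₀ ≥ -1 + 1/128 + 2δ`, and lies in the discrete triangle. -/
theorem touchExponent_wired_region {δ : ℝ} (hδ : 0 < δ) {a p q : ℤ}
    (h4a : 4 * a + 2 * q + 8 ≤ -6)
    (hcorner : -1 + 1 / 128 + 2 * δ ≤ δ * ((a : ℝ) + 2 * p + 10) / 2)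
    (hlev : -1 < δ * ((p : ℝ) + 5)) {w : Site 2} (hc1 : a + (p + 5) ≤ col w)
    (hc2 : col w ≤ 2 * q - 2 * p - 2 + 2 * a + (p + 5)) (hh1 : p + 5 ≤ hgtOf w)
    (hh2 : hgtOf w ≤ 2 * a + (p + 5)) (hw1 : w 1 ≤ -1) :
    w 0 ≤ -3 ∧ -1 + 1 / 128 + 2 * δ ≤ δ * w 0 ∧ w ∈ meshVertices Δ δ := by
  simp only [col, hgtOf] at hc1 hc2 hh1 hh2
  have hw0 : w 0 ≤ -3 := by omega
  have hlo : a + 2 * p + 10 ≤ 2 * w 0 := by omega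
  have hlo' : ((a : ℝ) + 2 * p + 10) ≤ 2 * ((w 0 : ℤ) : ℝ) := by exact_mod_cast hlo
  have hcor : -1 + 1 / 128 + 2 * δ ≤ δ * w 0 := by nlinarith
  refine ⟨hw0, hcor, (touchExponent_mem_triV_iff hδ).2 ⟨by omega, hw1, ?_⟩⟩
  have : ((p : ℝ) + 5) ≤ ((w 0 : ℤ) : ℝ) + w 1 := by
    have : p + 5 ≤ w 0 + w 1 := hh1
    exact_mod_cast this
  nlinarith

/-! ### The registered helper -/

/-- **L2 `touchExponent_wiredArmLower`** (registered helper for `stub_touchExponent`: the WIRED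
ARM lower bound). Conditional on Ikhlef–Ponsaing's Prop. 4.7 (`IkhlefPonsaingFirstPassage`): for
the triangle Dobrushin domain `(Δ; -1, -i)` (carrier `{re < 0, im < 0, re + im > -1}`, wired arc
the two legs, free arc the hypotenuse) and every `ℤ²`-discretisation family `E` of it, there are
`c > 0` and `ε₀ > 0` such that for every `ε ∈ (0, ε₀)` and all small meshes `δ`, with
`P_{1/2}`-probability at least `c ε^{1/3}` some site of the discrete wired arc is joined, by a path
open in the boundary-condition-completed configuration `bcBondConfig ω`, to a site within `ε/4` of
the midpoint `z = -(1+i)/2` of the hypotenuse, while some site of the discrete free arc lies within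
`ε/4` of `z`.

Proof: the two-scale diagonal half-plane arm of T3 (`touchExponent_twoScaleArm`, lower half) from
scale `≍ ε/δ` to scale `≍ 1/δ`, four rows above the hypotenuse, is caught by a U of box crossings
(`HalfPlaneArm.uCatch`) whose bar is part of a long left–right crossing reaching the wired leg
`[-1, 0]` (RSW at `p = 1/2` in the diagonal orientation, Harris–FKG: `touchExponent_wiredArmLower_glue`,
`touchExponent_glue0`); everything happens at distance `> 2δ` from the hypotenuse and away from
the acute corners, hence off the discrete free arc (`touchExponent_notMem_zdArcB`), so the path is
`bcBondConfig ω`-open (`touchExponent_bc_openConnIn`) and its end on the row `v₁ = -1` is a site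
of the discrete wired arc (`touchExponent_mem_zdArcA_of_row`); the level-`0` estimate is carried
to the level of the triangle by translation invariance of `P_{1/2}`
(`bondPercolation_real_preimage_relabel_iso`). The free-arc site is the lowest-row site below `z`
(`touchExponent_wiredArmLower_freeSite`). -/
theorem touchExponent_wiredArmLower : Literature.Probability.Percolation.IkhlefPonsaingFirstPassage → ∀ (D : DobrushinDomain) (E : ℝ → DiscreteDobrushin), D.carrier = {w : ℂ | w.re < 0 ∧ w.im < 0 ∧ -1 < w.re + w.im} → D.pt 0 = -1 → D.pt 1 = -Complex.I → D.arc 0 = segment ℝ (-1 : ℂ) 0 ∪ segment ℝ (0 : ℂ) (-Complex.I) → D.arc 1 = segment ℝ (-Complex.I) (-1 : ℂ) → ZdDiscretisationFamily D E → ∃ c ε₀ : ℝ, 0 < c ∧ 0 < ε₀ ∧ ∀ ε ∈ Set.Ioo 0 ε₀, ∀ᶠ δ in nhdsWithin (0 : ℝ) (Set.Ioi 0), c * ε ^ (1 / 3 : ℝ) ≤ (bondPercolation (zdGraph 2) half).real {ω | ∃ u ∈ (E δ).zdArcA, ∃ v : Site 2, ∃ w ∈ (E δ).zdArcB, dist (meshPoint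 δ v) (-(1 + Complex.I) / 2) ≤ ε / 4 ∧ dist (meshPoint δ w) (-(1 + Complex.I) / 2) ≤ ε / 4 ∧ (E δ).bcBondConfig ω ∈ openConnIn Set.univ u v} := by
  intro hIP D E hcar hp0 hp1 hA0 hA1 hE
  obtain ⟨c, hc, m₀, -, hG⟩ := touchExponent_wiredArmLower_glue hIP
  obtain ⟨hzarc, hpt, hKfar⟩ := touchExponent_z_far D hp0 hp1 hA0 hA1
  set z : ℂ := -(1 + Complex.I) / 2 with hz
  have hzf : z ∈ frontier D.carrier := D.arc_subset_frontier 1 hzarc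
  refine ⟨c, 1 / 8, hc, by norm_num, fun ε hε => ?_⟩
  obtain ⟨hε0, hε1⟩ := hε
  -- eventual facts along the mesh filter
  have h1 : ∀ᶠ δ in 𝓝[>] (0 : ℝ), δ ≤ min (ε / (64 * ((m₀ : ℝ) + 1))) (1 / 4096) :=
    mem_nhdsWithin_of_mem_nhds (Iic_mem_nhds (by positivity))
  have h2 : ∀ᶠ δ in 𝓝[>] (0 : ℝ), 0 < δ := self_mem_nhdsWithin
  have h3 : ∀ᶠ δ in 𝓝[>] (0 : ℝ),
      hausdorffEDist (E δ).arcB (D.arc 1) < ENNReal.ofReal (1 / 512) :=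
    hE.tendsto_arcB.eventually (Iio_mem_nhds (ENNReal.ofReal_pos.2 (by norm_num)))
  filter_upwards [touchExponent_eventually_far D hE hzf hpt hKfar, h1, h2, h3] with δ hfar hδle hδ hH
  obtain ⟨hadm, -, hside⟩ := hfar
  have hδε : δ ≤ ε / (64 * ((m₀ : ℝ) + 1)) := hδle.trans (min_le_left _ _)
  have hδ1 : δ ≤ 1 / 4096 := hδle.trans (min_le_right _ _)
  -- the scales
  obtain ⟨p, hp⟩ : ∃ p : ℤ, p = ⌊-1 / δ⌋ := ⟨_, rfl⟩
  obtain ⟨q, hq⟩ : ∃ q : ℤ, q = ⌊-1 / (2 * δ)⌋ := ⟨_, rfl⟩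
  obtain ⟨a, ha⟩ : ∃ a : ℕ, a = ⌊1 / (64 * δ)⌋₊ := ⟨_, rfl⟩
  obtain ⟨r, hr⟩ : ∃ r : ℕ, r = ⌊ε / (16 * δ)⌋₊ := ⟨_, rfl⟩
  obtain ⟨hm₀r, hm₀a, hra, ha1, h3a, h2r, h0, h67, h4a, hcorner, hlev, hdist1, hdist2, hεr, ha0⟩ :=
    touchExponent_wired_scales hε0 hε1 hδ hδε hδ1 ha hr hp hq
  -- the base point at level `0` and the shift to the level `L = p + 5` of the triangle
  set b₀ : Site 2 := ![q - p - 1, p + 1 - q] with hb₀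
  set t : Site 2 := ![p + 5, 0] with ht
  have hb₀h : hgtOf b₀ = 0 := by
    simp only [hgtOf, hb₀, Matrix.cons_val_zero, Matrix.cons_val_one, Matrix.cons_val_fin_one]; ring
  have hb₀c : col b₀ = 2 * q - 2 * p - 2 := by
    simp only [col, hb₀, Matrix.cons_val_zero, Matrix.cons_val_one, Matrix.cons_val_fin_one]; ring
  -- the level-`0` estimate
  have hprob := hG b₀ r a hb₀h hm₀r hm₀a hra (by rw [hb₀c]; exact h0) (by rw [hb₀c]; exact h67)
  have hlow : c * ε ^ (1 / 3 : ℝ) ≤ c * ((r : ℝ) / (2 * a)) ^ (1 / 3 : ℝ) :=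
    mul_le_mul_of_nonneg_left (Real.rpow_le_rpow hε0.le hεr (by norm_num)) hc.le
  refine hlow.trans (hprob.trans ?_)
  -- transport to the level of the triangle: `P(G₀) ≤ P(shift⁻¹ F) = P(F)`
  refine le_trans ?_ (le_of_eq (bondPercolation_real_preimage_relabel_iso (zdShiftIso t) half _))
  refine ENNReal.toReal_mono (measure_ne_top _ _) (measure_mono_ae ?_)
  filter_upwards [ae_subset_edgeSet (zdGraph 2) half] with ω hω hωG
  obtain ⟨⟨⟨hωE, hωR⟩, hωL⟩, hωH⟩ := hωG
  obtain ⟨x, u₀, hx, hx0, hu₀, hconn⟩ := touchExponent_glue0 hω hb₀h (by exact_mod_cast ha1)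
    (by exact_mod_cast hra) (by rw [hb₀c]; exact h3a) (by rw [hb₀c]; exact h2r) hωE hωR hωL hωH
  set S₀ : Set (Site 2) := box[(a : ℤ), col b₀ + 2 * a, 0, 2 * a] ∩ {v : Site 2 | v 1 ≤ -1} with hS₀
  -- the shifted configuration and the shifted path
  have hconn' := relabel_mem_openConnIn (zdShiftIso t).toEquiv hconn
  set ω' : BondConfig (Site 2) := BondConfig.relabel (sym2Equiv (zdShiftIso t).toEquiv) ω with hω'
  have hω'E : ω' ⊆ (zdGraph 2).edgeSet := by
    intro e he
    rw [hω', BondConfig.relabel_apply] at he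
    obtain ⟨e₀, he₀, rfl⟩ := he
    exact (sym2Equiv_mem_edgeSet_iff (zdShiftIso t) e₀).2 (hω he₀)
  -- the shifted region lies in the triangle, off the free arc, four rows above the hypotenuse
  have hS : ∀ w ∈ ((zdShiftIso t).toEquiv : Site 2 → Site 2) '' S₀,
      w ∈ meshVertices Δ δ ∧ w ∉ (E δ).zdArcB := by
    rintro w ⟨v, ⟨⟨hv1, hv2, hv3, hv4⟩, hv5⟩, rfl⟩
    have hv5 : v 1 ≤ -1 := hv5
    have ew : ((zdShiftIso t).toEquiv : Site 2 → Site 2) v = v + t := rfl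
    rw [ew]
    have ec : col (v + t) = col v + (p + 5) := by
      simp only [col, ht, Pi.add_apply, Matrix.cons_val_zero, Matrix.cons_val_one,
        Matrix.cons_val_fin_one]; ring
    have eh : hgtOf (v + t) = hgtOf v + (p + 5) := by
      simp only [hgtOf, ht, Pi.add_apply, Matrix.cons_val_zero, Matrix.cons_val_one,
        Matrix.cons_val_fin_one]; ring
    have e1 : (v + t) 1 = v 1 := by
      simp only [ht, Pi.add_apply, Matrix.cons_val_one, Matrix.cons_val_fin_one]; ring
    rw [hb₀c] at hv2
    obtain ⟨hw0, hwc, hwV⟩ := touchExponent_wired_region hδ h4a hcorner hlev (w := v + t)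
      (by rw [ec]; omega) (by rw [ec]; omega) (by rw [eh]; omega) (by rw [eh]; omega)
      (by rw [e1]; exact hv5)
    exact ⟨hwV, touchExponent_notMem_zdArcB D hcar hA1 hE hδ hδ1 hH (by rw [← hp, eh]; omega)
      hw0 hwc⟩
  -- the inner end is within `ε/4` of `z`
  have hbL : b₀ + t = ![q + 4, p + 1 - q] := by
    funext i; fin_cases i
    · simp [hb₀, ht]; ring
    · simp [hb₀, ht]
  have hbLz : dist (meshPoint δ (b₀ + t)) z ≤ 7 * δ := by
    have h1 : dist (meshPoint δ ![q, p + 1 - q]) z ≤ 3 * δ := by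
      rw [hp, hq]; exact touchExponent_dist_base_le hδ
    have h2 : dist (meshPoint δ (b₀ + t)) (meshPoint δ ![q, p + 1 - q]) ≤ 4 * δ := by
      rw [Complex.dist_eq]
      have : meshPoint δ (b₀ + t) - meshPoint δ ![q, p + 1 - q] = ((4 * δ : ℝ) : ℂ) := by
        apply Complex.ext
        · simp [hbL]; ring
        · simp [hbL]
      rw [this, Complex.norm_real, Real.norm_eq_abs, abs_of_pos (by positivity)]
    linarith [dist_triangle (meshPoint δ (b₀ + t)) (meshPoint δ ![q, p + 1 - q]) z]
  have hxz : dist (meshPoint δ (x + t)) z ≤ ε / 4 := by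
    have hby : hgtOf (b₀ + t) ≤ hgtOf (x + t) := by
      simp only [hgtOf, Pi.add_apply] at hx0 hb₀h ⊢; omega
    have h1 := touchExponent_dist_le_norm hδ hby
    have hν : max |col (x + t) - col (b₀ + t)| (hgtOf (x + t) - hgtOf (b₀ + t)) = r := by
      have e1 : col (x + t) - col (b₀ + t) = col x - col b₀ := by
        simp only [col, Pi.add_apply]; ring
      have e2 : hgtOf (x + t) - hgtOf (b₀ + t) = hgtOf x - hgtOf b₀ := by
        simp only [hgtOf, Pi.add_apply]; ring
      rw [e1, e2]; exact hx
    rw [hν] at h1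
    push_cast at h1
    linarith [dist_triangle (meshPoint δ (x + t)) (meshPoint δ (b₀ + t)) z]
  -- the outer end is a site of the discrete wired arc
  have hu' : u₀ + t ∈ ((zdShiftIso t).toEquiv : Site 2 → Site 2) '' S₀ := ⟨u₀, hconn.2.1, rfl⟩
  obtain ⟨huV, huB⟩ := hS _ hu'
  have huA : u₀ + t ∈ (E δ).zdArcA :=
    touchExponent_mem_zdArcA_of_row D hcar hE hδ (by linarith) hadm huV
      (by simp only [ht, Pi.add_apply, Matrix.cons_val_one, Matrix.cons_val_fin_one, hu₀]; ring) huB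
  -- a site of the discrete free arc next to `z`
  obtain ⟨w, hwB, hwz⟩ := touchExponent_exists_zdArcB_near D hcar hE hδ (by linarith) hadm hside
  -- the path is open in the completed configuration
  have hbc := touchExponent_bc_openConnIn D hcar hE hδ (by linarith) hω'E
    (S := ((zdShiftIso t).toEquiv : Site 2 → Site 2) '' S₀) (fun w hw => (hS w hw).1)
    (fun w hw => (hS w hw).2) hconn'
  refine ⟨u₀ + t, huA, x + t, w, hwB, hxz, by linarith, ?_⟩
  rw [openConnIn_comm]
  exact hbc

end Summit.CriticalPhenomena.CardyFormulaZ2.Theorems.SymmetryUpgradeR.SwallowingSkeleton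

end
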